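import Summits.BirchSwinnertonDyer.BirchSwinnertonDyer.Theorems.ByReductionTypeAtTwoRankOneAtTwoBigImageOddLocalOneDoorHalves
import Summits.BirchSwinnertonDyer.BirchSwinnertonDyer.Theorems.ByReductionTypeAtTwoRankOneAtTwoBigImageOddLocalOneDoorFullCPrimary
import Summits.BirchSwinnertonDyer.BirchSwinnertonDyer.Theorems.ByReductionTypeAtTwoRankOneAtTwoFklDefs
import Summits.BirchSwinnertonDyer.BirchSwinnertonDyer.Theorems.ByReductionTypeAtTwoRankOneAtTwoBigImageOddLocalOneDoorIndexLawOfKolyvaginExact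
import HarnessLib

/-!
# Route ByReductionTypeAtTwo, crux `RankOneAtTwoBigImageOddLocal` (stmt-BirchSwinnertonDyer-23715), LINE v8.5 `one_door_analytic`:
# the E-side HALVES on the whole slice — the one-sided door laws give the one-sided `BSD₂`, the residue (5b) BY NAME, and conversely

Width prover seat `bsd-line-fkl-p2` g8 (2026-08-28), `--supports stmt-BirchSwinnertonDyer-23715`.  THEOREMS ONLY; nothing is asserted;
BSD is not proved by any of this.  Sequel of `…OneDoorValuation.lean` / `…OneDoorHalves.lean` (per-datum E-side halves); E-side twin of
`…OneDoorHalvesKSlice.lean`.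

The load-bearing conjecture AN-28c `DoorIndexLawFullCAtTwo` of the line of record is an IDENTITY at every door datum; write AN-28c(≥) for
the same statement with conclusion `s_E + s_d + t + 2s + 2·v₂(c) ≤ 2m + [Δ_W<0]` («the Heegner point is divisible ENOUGH») and AN-28c(≤)
for the reverse inequality.  They are displayed below as explicit hypotheses (`hGe`, `hLe`; no new definition is introduced).  Modulo the
four PRIMARY printed facts of `S_pub4` (`gross_zagier`, `kolyvagin`, `exists_isNewformOf`, Hoffstein–Luo 1997) and the route's four
rank-`0` cruxes at `2` BY NAME (or `S_rankZeroTwin`):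

* §1 `missingUpperBoundAt_two_onSlice_of_doorLawGeC_primary4` — **AN-28c(≥) ⟹ the Euler-system half `ord₂ #Ш(W) ≤ ord₂ #Ш_an(W)` for
  EVERY `W` on the slice**; `missingLowerBoundAt_two_onSlice_of_doorLawLeC_primary4` — AN-28c(≤) ⟹ the main-conjecture half; the glue is
  the lead's Manin-free `doorGlueAnC_of_primary` run on the one-sided iffs `missingUpperBoundAt_two_iff_doorLawGeC_at` /
  `missingLowerBoundAt_two_iff_doorLawLeC_at` (door field by Hoffstein–Luo, ANY datum by modularity, `rank E(ℚ) = 1` from the four facts).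
* §2 `shaAnTwoIntegralOnBigImageSlice_of_doorLawGeC_primary4` — the OPEN residue (5b) of the old fkl line,
  `RankOneAtTwoFkl.ShaAnTwoIntegralOnBigImageSlice`, BY NAME from AN-28c(≥) (it sits under the Euler-system half).
* §3 `rankOneAtTwoBigImageOddLocal_of_doorLawGeC_of_doorLawLeC_primary4` — the crux BY NAME from AN-28c(≥) ∧ AN-28c(≤) + PRINT⁴ + the four
  rank-`0` cruxes (both halves ⟹ `BSD(W,2)`; = the lead's assembly with the conjecture split in two).
* §4 losslessness: `doorLawGeC_of_missingUpperBoundAt_onSlice` — the Euler-system half ON THE SLICE gives back AN-28c(≥) at every door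
  datum (modulo Gross–Zagier / Kolyvagin at `(N_W, W, K)`, GZK, modularity, `S_rankZeroTwin`), the one-sided form of g7's
  `doorIndexLawFullCAtTwo_of_bsdp`; dually `doorLawLeC_of_missingLowerBoundAt_onSlice`.

So, modulo PRINT and rank-`0` `BSD₂`, **Euler-system half of 23715 ⟺ AN-28c(≥) ⟺ Kolyvagin's upper bound at `2` over `K`** and
**main-conjecture half ⟺ AN-28c(≤) ⟺ the reverse K-inequality** (this file with `…OneDoorHalvesKSlice.lean`), refining the g7 iffs
crux ⟺ AN-28c ⟺ hXC.  Conditional by design throughout.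

References: [GrossZagier1986] Thm. I.6.3, V.§2; [GrossLMS1991] Thm. 1.3, §2 Conj. (2.2); [Miller2011LMS] Def. 1.1.
-/

set_option autoImplicit false

noncomputable section

open scoped Classical

set_option linter.dupNamespace false

namespace Summit.BirchSwinnertonDyer.BirchSwinnertonDyer.Theorems.RankOneAtTwoOneDoor

open WeierstrassCurve NumberField IsDedekindDomain Rat.HeightOneSpectrum Literature.NumberTheory.EllipticCurves
  Literature.NumberTheory.EllipticCurves.ModularForms
  Literature.NumberTheory.EllipticCurves.KrizLi2019
  Literature.NumberTheory.EllipticCurves.Rank1Residual.Typed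
  Summit.BirchSwinnertonDyer.Rank1Residual.F1Sign2
  Summit.BirchSwinnertonDyer.Rank1Residual.F1Sign2.TranspositionDoor
  Summit.BirchSwinnertonDyer.Rank1Residual
  Summit.BirchSwinnertonDyer.BirchSwinnertonDyer.Theses.ByReductionTypeAtTwo
  Summit.BirchSwinnertonDyer.BirchSwinnertonDyer.Theorems.RankOneAtTwoFkl

/-! ### §0 The door package of a curve on the slice (the opening of the lead's `doorGlueAnC_of_primary`) -/

/-- For `W` on the slice (analytic rank `1`, non-CM), the four primary facts and `S_rankZeroTwin` provide: `rank E(ℚ) = 1`, a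
door-admissible Heegner field `K` with `L(E^{(d_K)},1) ≠ 0` (Hoffstein–Luo), a parametrisation datum `Dt` of ANY constant (modularity), a
Heegner datum `H`, an embedding `ι`, the `K`-rational Heegner point `P`, and a globally minimal twin `Wd = Cd • W^{(d_K)}` with
`BSD(Wd,2)` (non-CM of analytic rank `0`). [cite: GrossZagier1986, V.§2] -/
theorem exists_doorPackage_onSlice_primary
    (hGZ : ∀ (N : ℕ) [NeZero N] (W : WeierstrassCurve ℚ) (K : Type) [Field K] [NumberField K], gross_zagier N W K)
    (hKo : ∀ (N : ℕ) [NeZero N] (W : WeierstrassCurve ℚ) (K : Type) [Field K] [NumberField K], kolyvagin N W K)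
    (hnf : exists_isNewformOf) (hHL : HoffsteinLuo1997_exists_twist_L_one_ne_zero) (hZ : S_rankZeroTwin)
    (W : WeierstrassCurve ℚ) [W.IsElliptic] [W.IsGloballyMinimal] [NeZero (W.conductorNorm ℤ)]
    (hCM : ¬ W.HasCM) (hr : W.analyticRank = 1) :
    W.mordellWeilRank = 1 ∧
    ∃ (K : Type) (_ : Field K) (_ : NumberField K), IsImaginaryQuadratic K ∧ DoorAdmissible W (NumberField.discr K) ∧
      SatisfiesHeegnerHypothesis (W.conductorNorm ℤ) K ∧ (W.quadraticTwist (NumberField.discr K : ℚ)).entireLFunction 1 ≠ 0 ∧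
      ∃ (Dt : ModularParametrizationData W (W.conductorNorm ℤ)) (H : HeegnerDatum (W.conductorNorm ℤ) (NumberField.discr K))
        (ι : K →+* ℂ) (P : (W.baseChange K).toAffine.Point) (Cd : VariableChange ℚ),
        WeierstrassCurve.Affine.Point.map ι.toRatAlgHom P = heegnerPointComplex Dt H ∧
        (Cd • W.quadraticTwist (NumberField.discr K : ℚ)).IsElliptic ∧
        ∃ _ : (Cd • W.quadraticTwist (NumberField.discr K : ℚ)).IsGloballyMinimal,
          BSDp (Cd • W.quadraticTwist (NumberField.discr K : ℚ)) 2 := by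
  have hmod : hasEntireLFunction_rat := hasEntireLFunction_rat_of_exists_isNewformOf hnf
  have hrk : W.mordellWeilRank = 1 :=
    (mordellWeilRank_eq_one_of_analyticRank_eq_one_of_isGloballyMinimal hGZ hKo hnf hHL W hr).1
  obtain ⟨K, _iF, _iN, hK, hadm, hLt, -, hHN⟩ := doorSupplyAnalyticAtTwo_of_hoffsteinLuo hnf hHL W hr
  obtain ⟨Dt⟩ := (nonempty_modularParametrizationData_iff_exists_isNewformOf_unconditional.mpr hnf) W
  obtain ⟨H, -⟩ :=
    nonempty_heegnerDatum_holds (W.conductorNorm ℤ) K hK (exists_dvd_sq_sub_discr_holds (W.conductorNorm ℤ) K hK hHN).choose_spec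
  obtain ⟨ι⟩ : Nonempty (K →+* ℂ) := inferInstance
  obtain ⟨P, hP⟩ := heegnerPointComplex_mem_range_map_holds (W.conductorNorm ℤ) W K hK hHN Dt H ι
  have hD0 : (NumberField.discr K : ℚ) ≠ 0 := by exact_mod_cast NumberField.discr_ne_zero K
  haveI hEt : (W.quadraticTwist (NumberField.discr K : ℚ)).IsElliptic := W.isElliptic_quadraticTwist hD0
  obtain ⟨Cd, hCd⟩ := hasGlobalMinimalModel_rat_holds (W.quadraticTwist (NumberField.discr K : ℚ))
  haveI : (Cd • W.quadraticTwist (NumberField.discr K : ℚ)).IsGloballyMinimal := hCd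
  have hCMd : ¬ (Cd • W.quadraticTwist (NumberField.discr K : ℚ)).HasCM :=
    RamifiedPairUpperBound.not_hasCM_of_smul_quadraticTwist_eq hD0 rfl hCM
  have hLeq : (Cd • W.quadraticTwist (NumberField.discr K : ℚ)).entireLFunction =
      (W.quadraticTwist (NumberField.discr K : ℚ)).entireLFunction := by
    rw [entireLFunction_smul]
  have hrd : (Cd • W.quadraticTwist (NumberField.discr K : ℚ)).analyticRank = 0 :=
    ((Cd • W.quadraticTwist _).analyticRank_eq_zero_iff_holds (hmod _)).2 (by rw [hLeq]; exact hLt)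
  have hBd : BSDp (Cd • W.quadraticTwist (NumberField.discr K : ℚ)) 2 := hZ _ hCMd hrd
  exact ⟨hrk, K, _iF, _iN, hK, hadm, hHN, hLt, Dt, H, ι, P, Cd, hP, inferInstance, hCd, hBd⟩

/-! ### §1 The one-sided door laws ⟹ the one-sided `BSD₂` on the whole slice -/

/-- **AN-28c(≥) ⟹ THE EULER-SYSTEM HALF OF `BSD₂` ON THE WHOLE SLICE**, modulo the four primary facts and `S_rankZeroTwin`: if at every
non-vanishing door datum the Heegner point is divisible ENOUGH (`s_E + s_d + t + 2s + 2·v₂(c) ≤ 2m + [Δ_W<0]`, binder `hGe`), then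
`ord₂ #Ш(W) ≤ ord₂ #Ш_an(W)` for every `W` on the slice of 23715.  Conditional by design.
[cite: GrossLMS1991, Thm. 1.3 and §2 Conj. (2.2)] [cite: Miller2011LMS, Def. 1.1] -/
theorem missingUpperBoundAt_two_onSlice_of_doorLawGeC
    (hGZ : ∀ (N : ℕ) [NeZero N] (W : WeierstrassCurve ℚ) (K : Type) [Field K] [NumberField K], gross_zagier N W K)
    (hKo : ∀ (N : ℕ) [NeZero N] (W : WeierstrassCurve ℚ) (K : Type) [Field K] [NumberField K], kolyvagin N W K)
    (hnf : exists_isNewformOf) (hHL : HoffsteinLuo1997_exists_twist_L_one_ne_zero)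
    (hGe : ∀ (W : WeierstrassCurve ℚ) [W.IsElliptic] [W.IsGloballyMinimal] [NeZero (W.conductorNorm ℤ)],
      ¬ W.HasCM → (∀ n : ℕ, W.HasSurjectiveModNGaloisRep ((2 ^ n : ℕ) : ℤ)) → Odd W.torsionOrder → Odd W.tamagawaProduct →
      W.analyticRank = 1 →
      ∀ (K : Type) [Field K] [NumberField K], IsImaginaryQuadratic K → DoorAdmissible W (NumberField.discr K) →
        (W.quadraticTwist (NumberField.discr K : ℚ)).entireLFunction 1 ≠ 0 →
        ∀ (Dt : ModularParametrizationData W (W.conductorNorm ℤ)) (H : HeegnerDatum (W.conductorNorm ℤ) (NumberField.discr K))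
          (ι : K →+* ℂ) (P : (W.baseChange K).toAffine.Point),
          WeierstrassCurve.Affine.Point.map ι.toRatAlgHom P = heegnerPointComplex Dt H →
          ∀ (Wd : WeierstrassCurve ℚ) [Wd.IsElliptic] [Wd.IsGloballyMinimal] (Cd : VariableChange ℚ),
            Cd • W.quadraticTwist (NumberField.discr K : ℚ) = Wd →
            ∃ m : ℕ, HasTwoDivisibilityUpToTorsion W K P m ∧
              padicValNat 2 (Nat.card (AddCommGroup.primaryComponent W.sha 2)) +
                  padicValNat 2 (Nat.card (AddCommGroup.primaryComponent Wd.sha 2)) +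
                  transpCount W (NumberField.discr K) + 2 * identCount W (NumberField.discr K) + 2 * padicValInt 2 Dt.c ≤
                2 * m + (if W.Δ < 0 then 1 else 0))
    (hZ : S_rankZeroTwin) :
    ∀ (W : WeierstrassCurve ℚ) [W.IsElliptic] [W.IsGloballyMinimal], ¬ W.HasCM →
      (∀ n : ℕ, W.HasSurjectiveModNGaloisRep ((2 ^ n : ℕ) : ℤ)) → Odd W.torsionOrder → Odd W.tamagawaProduct →
      W.analyticRank = 1 → MissingUpperBoundAt W 2 := by
  intro W _ _ hCM hsurj hT hc hr
  have hmod : hasEntireLFunction_rat := hasEntireLFunction_rat_of_exists_isNewformOf hnf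
  haveI hN : NeZero (W.conductorNorm ℤ) := ⟨(W.conductorNorm_pos_holds).ne'⟩
  obtain ⟨hrk, K, _iF, _iN, hK, hadm, hHN, hLt, Dt, H, ι, P, Cd, hP, _, _, hBd⟩ :=
    exists_doorPackage_onSlice_primary hGZ hKo hnf hHL hZ W hCM hr
  exact (missingUpperBoundAt_two_iff_doorLawGeC_at hmod doorTwistTamagawaAtTwo W hT hc hr hrk K hK (hGZ _ W K) (hKo _ W K) hadm hHN
    hLt Dt H ι P hP _ Cd rfl hBd).mpr (hGe W hCM hsurj hT hc hr K hK hadm hLt Dt H ι P hP _ Cd rfl)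

/-- **AN-28c(≤) ⟹ THE MAIN-CONJECTURE HALF OF `BSD₂` ON THE WHOLE SLICE**, modulo the four primary facts and `S_rankZeroTwin`: if at every
non-vanishing door datum the Heegner point is NOT divisible beyond the prediction (`2m + [Δ_W<0] ≤ s_E + s_d + t + 2s + 2·v₂(c)`, binder
`hLe`), then `ord₂ #Ш_an(W) ≤ ord₂ #Ш(W)` for every `W` on the slice.  Conditional by design.
[cite: GrossLMS1991, §2 Conj. (2.2)] [cite: Miller2011LMS, Def. 1.1] -/
theorem missingLowerBoundAt_two_onSlice_of_doorLawLeC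
    (hGZ : ∀ (N : ℕ) [NeZero N] (W : WeierstrassCurve ℚ) (K : Type) [Field K] [NumberField K], gross_zagier N W K)
    (hKo : ∀ (N : ℕ) [NeZero N] (W : WeierstrassCurve ℚ) (K : Type) [Field K] [NumberField K], kolyvagin N W K)
    (hnf : exists_isNewformOf) (hHL : HoffsteinLuo1997_exists_twist_L_one_ne_zero)
    (hLe : ∀ (W : WeierstrassCurve ℚ) [W.IsElliptic] [W.IsGloballyMinimal] [NeZero (W.conductorNorm ℤ)],
      ¬ W.HasCM → (∀ n : ℕ, W.HasSurjectiveModNGaloisRep ((2 ^ n : ℕ) : ℤ)) → Odd W.torsionOrder → Odd W.tamagawaProduct →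
      W.analyticRank = 1 →
      ∀ (K : Type) [Field K] [NumberField K], IsImaginaryQuadratic K → DoorAdmissible W (NumberField.discr K) →
        (W.quadraticTwist (NumberField.discr K : ℚ)).entireLFunction 1 ≠ 0 →
        ∀ (Dt : ModularParametrizationData W (W.conductorNorm ℤ)) (H : HeegnerDatum (W.conductorNorm ℤ) (NumberField.discr K))
          (ι : K →+* ℂ) (P : (W.baseChange K).toAffine.Point),
          WeierstrassCurve.Affine.Point.map ι.toRatAlgHom P = heegnerPointComplex Dt H →
          ∀ (Wd : WeierstrassCurve ℚ) [Wd.IsElliptic] [Wd.IsGloballyMinimal] (Cd : VariableChange ℚ),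
            Cd • W.quadraticTwist (NumberField.discr K : ℚ) = Wd →
            ∃ m : ℕ, HasTwoDivisibilityUpToTorsion W K P m ∧
              2 * m + (if W.Δ < 0 then 1 else 0) ≤
                padicValNat 2 (Nat.card (AddCommGroup.primaryComponent W.sha 2)) +
                  padicValNat 2 (Nat.card (AddCommGroup.primaryComponent Wd.sha 2)) +
                  transpCount W (NumberField.discr K) + 2 * identCount W (NumberField.discr K) + 2 * padicValInt 2 Dt.c)
    (hZ : S_rankZeroTwin) :
    ∀ (W : WeierstrassCurve ℚ) [W.IsElliptic] [W.IsGloballyMinimal], ¬ W.HasCM →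
      (∀ n : ℕ, W.HasSurjectiveModNGaloisRep ((2 ^ n : ℕ) : ℤ)) → Odd W.torsionOrder → Odd W.tamagawaProduct →
      W.analyticRank = 1 → MissingLowerBoundAt W 2 := by
  intro W _ _ hCM hsurj hT hc hr
  have hmod : hasEntireLFunction_rat := hasEntireLFunction_rat_of_exists_isNewformOf hnf
  haveI hN : NeZero (W.conductorNorm ℤ) := ⟨(W.conductorNorm_pos_holds).ne'⟩
  obtain ⟨hrk, K, _iF, _iN, hK, hadm, hHN, hLt, Dt, H, ι, P, Cd, hP, _, _, hBd⟩ :=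
    exists_doorPackage_onSlice_primary hGZ hKo hnf hHL hZ W hCM hr
  exact (missingLowerBoundAt_two_iff_doorLawLeC_at hmod doorTwistTamagawaAtTwo W hT hc hr hrk K hK (hGZ _ W K) (hKo _ W K) hadm hHN
    hLt Dt H ι P hP _ Cd rfl hBd).mpr (hLe W hCM hsurj hT hc hr K hK hadm hLt Dt H ι P hP _ Cd rfl)

/-! ### §2 The fkl residue (5b) BY NAME under AN-28c(≥) -/

/-- **`RankOneAtTwoFkl.ShaAnTwoIntegralOnBigImageSlice` (the OPEN residue (5b) of the old fkl line) FROM AN-28c(≥)** (binder `hGe`), the four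
primary facts and `S_rankZeroTwin`: on the slice `0 ≤ ord₂ #Ш(W) ≤ ord₂ #Ш_an(W)`.  Conditional by design.
[cite: GrossLMS1991, Thm. 1.3] [cite: Miller2011LMS, Def. 1.1] -/
theorem shaAnTwoIntegralOnBigImageSlice_of_doorLawGeC
    (hGZ : ∀ (N : ℕ) [NeZero N] (W : WeierstrassCurve ℚ) (K : Type) [Field K] [NumberField K], gross_zagier N W K)
    (hKo : ∀ (N : ℕ) [NeZero N] (W : WeierstrassCurve ℚ) (K : Type) [Field K] [NumberField K], kolyvagin N W K)
    (hnf : exists_isNewformOf) (hHL : HoffsteinLuo1997_exists_twist_L_one_ne_zero)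
    (hGe : ∀ (W : WeierstrassCurve ℚ) [W.IsElliptic] [W.IsGloballyMinimal] [NeZero (W.conductorNorm ℤ)],
      ¬ W.HasCM → (∀ n : ℕ, W.HasSurjectiveModNGaloisRep ((2 ^ n : ℕ) : ℤ)) → Odd W.torsionOrder → Odd W.tamagawaProduct →
      W.analyticRank = 1 →
      ∀ (K : Type) [Field K] [NumberField K], IsImaginaryQuadratic K → DoorAdmissible W (NumberField.discr K) →
        (W.quadraticTwist (NumberField.discr K : ℚ)).entireLFunction 1 ≠ 0 →
        ∀ (Dt : ModularParametrizationData W (W.conductorNorm ℤ)) (H : HeegnerDatum (W.conductorNorm ℤ) (NumberField.discr K))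
          (ι : K →+* ℂ) (P : (W.baseChange K).toAffine.Point),
          WeierstrassCurve.Affine.Point.map ι.toRatAlgHom P = heegnerPointComplex Dt H →
          ∀ (Wd : WeierstrassCurve ℚ) [Wd.IsElliptic] [Wd.IsGloballyMinimal] (Cd : VariableChange ℚ),
            Cd • W.quadraticTwist (NumberField.discr K : ℚ) = Wd →
            ∃ m : ℕ, HasTwoDivisibilityUpToTorsion W K P m ∧
              padicValNat 2 (Nat.card (AddCommGroup.primaryComponent W.sha 2)) +
                  padicValNat 2 (Nat.card (AddCommGroup.primaryComponent Wd.sha 2)) +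
                  transpCount W (NumberField.discr K) + 2 * identCount W (NumberField.discr K) + 2 * padicValInt 2 Dt.c ≤
                2 * m + (if W.Δ < 0 then 1 else 0))
    (hZ : S_rankZeroTwin) : ShaAnTwoIntegralOnBigImageSlice := by
  intro W _ _ hCM hsurj hT hc hr q hq
  obtain ⟨q', hq', hle⟩ := missingUpperBoundAt_two_onSlice_of_doorLawGeC hGZ hKo hnf hHL hGe hZ W hCM hsurj hT hc hr
  have hqq : q = q' := by exact_mod_cast hq.symm.trans hq'
  rw [hqq]
  exact le_trans (by exact_mod_cast Nat.zero_le _) hle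

/-! ### §3 The crux BY NAME from the two one-sided door laws -/

/-- **Crux `RankOneAtTwoBigImageOddLocal` BY NAME from AN-28c(≥) ∧ AN-28c(≤)**, the four primary facts (`gross_zagier`, `kolyvagin`,
`exists_isNewformOf`, Hoffstein–Luo 1997) and the route's four rank-`0` cruxes at `2` BY NAME: both halves hold on the slice (§1), hence
Miller's `BSD(W,2)` (rank part and finiteness by the four facts).  = the line's assembly `rankOneAtTwoBigImageOddLocal_of_oneDoorAnalyticC_primary4`
with the conjecture split in two (`doorLawFullC_at_iff_geC_and_leC`).  Conditional by design; BSD is not proved by this.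
[cite: GrossLMS1991, §2 Conj. (2.2)] [cite: Miller2011LMS, Def. 1.1] -/
theorem rankOneAtTwoBigImageOddLocal_of_doorLawGeC_of_doorLawLeC_primary4
    (hGZ : ∀ (N : ℕ) [NeZero N] (W : WeierstrassCurve ℚ) (K : Type) [Field K] [NumberField K], gross_zagier N W K)
    (hKo : ∀ (N : ℕ) [NeZero N] (W : WeierstrassCurve ℚ) (K : Type) [Field K] [NumberField K], kolyvagin N W K)
    (hnf : exists_isNewformOf) (hHL : HoffsteinLuo1997_exists_twist_L_one_ne_zero)
    (hGe : ∀ (W : WeierstrassCurve ℚ) [W.IsElliptic] [W.IsGloballyMinimal] [NeZero (W.conductorNorm ℤ)],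
      ¬ W.HasCM → (∀ n : ℕ, W.HasSurjectiveModNGaloisRep ((2 ^ n : ℕ) : ℤ)) → Odd W.torsionOrder → Odd W.tamagawaProduct →
      W.analyticRank = 1 →
      ∀ (K : Type) [Field K] [NumberField K], IsImaginaryQuadratic K → DoorAdmissible W (NumberField.discr K) →
        (W.quadraticTwist (NumberField.discr K : ℚ)).entireLFunction 1 ≠ 0 →
        ∀ (Dt : ModularParametrizationData W (W.conductorNorm ℤ)) (H : HeegnerDatum (W.conductorNorm ℤ) (NumberField.discr K))
          (ι : K →+* ℂ) (P : (W.baseChange K).toAffine.Point),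
          WeierstrassCurve.Affine.Point.map ι.toRatAlgHom P = heegnerPointComplex Dt H →
          ∀ (Wd : WeierstrassCurve ℚ) [Wd.IsElliptic] [Wd.IsGloballyMinimal] (Cd : VariableChange ℚ),
            Cd • W.quadraticTwist (NumberField.discr K : ℚ) = Wd →
            ∃ m : ℕ, HasTwoDivisibilityUpToTorsion W K P m ∧
              padicValNat 2 (Nat.card (AddCommGroup.primaryComponent W.sha 2)) +
                  padicValNat 2 (Nat.card (AddCommGroup.primaryComponent Wd.sha 2)) +
                  transpCount W (NumberField.discr K) + 2 * identCount W (NumberField.discr K) + 2 * padicValInt 2 Dt.c ≤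
                2 * m + (if W.Δ < 0 then 1 else 0))
    (hLe : ∀ (W : WeierstrassCurve ℚ) [W.IsElliptic] [W.IsGloballyMinimal] [NeZero (W.conductorNorm ℤ)],
      ¬ W.HasCM → (∀ n : ℕ, W.HasSurjectiveModNGaloisRep ((2 ^ n : ℕ) : ℤ)) → Odd W.torsionOrder → Odd W.tamagawaProduct →
      W.analyticRank = 1 →
      ∀ (K : Type) [Field K] [NumberField K], IsImaginaryQuadratic K → DoorAdmissible W (NumberField.discr K) →
        (W.quadraticTwist (NumberField.discr K : ℚ)).entireLFunction 1 ≠ 0 →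
        ∀ (Dt : ModularParametrizationData W (W.conductorNorm ℤ)) (H : HeegnerDatum (W.conductorNorm ℤ) (NumberField.discr K))
          (ι : K →+* ℂ) (P : (W.baseChange K).toAffine.Point),
          WeierstrassCurve.Affine.Point.map ι.toRatAlgHom P = heegnerPointComplex Dt H →
          ∀ (Wd : WeierstrassCurve ℚ) [Wd.IsElliptic] [Wd.IsGloballyMinimal] (Cd : VariableChange ℚ),
            Cd • W.quadraticTwist (NumberField.discr K : ℚ) = Wd →
            ∃ m : ℕ, HasTwoDivisibilityUpToTorsion W K P m ∧
              2 * m + (if W.Δ < 0 then 1 else 0) ≤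
                padicValNat 2 (Nat.card (AddCommGroup.primaryComponent W.sha 2)) +
                  padicValNat 2 (Nat.card (AddCommGroup.primaryComponent Wd.sha 2)) +
                  transpCount W (NumberField.discr K) + 2 * identCount W (NumberField.discr K) + 2 * padicValInt 2 Dt.c)
    (hZ4 : GoodOrdinaryRankZeroAtTwo ∧ MultiplicativeRankZeroAtTwo ∧ SupersingularRankZeroAtTwo ∧ AdditiveRankZeroAtTwo) :
    RankOneAtTwoBigImageOddLocal := by
  intro W _ _ hCM hsurj hT hc hr
  haveI : Fact (Nat.Prime 2) := ⟨Nat.prime_two⟩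
  have hZ : S_rankZeroTwin := fun V _ _ hVCM hV0 => bsdp_two_of_rankZero_cruxes hZ4 V hVCM hV0
  obtain ⟨hrk, hfin⟩ := mordellWeilRank_eq_one_of_analyticRank_eq_one_of_isGloballyMinimal hGZ hKo hnf hHL W hr
  exact (bsdp_two_iff_halves_of_rankOne W hr hrk hfin).mpr
    ⟨missingLowerBoundAt_two_onSlice_of_doorLawLeC hGZ hKo hnf hHL hLe hZ W hCM hsurj hT hc hr,
      missingUpperBoundAt_two_onSlice_of_doorLawGeC hGZ hKo hnf hHL hGe hZ W hCM hsurj hT hc hr⟩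

/-! ### §4 Losslessness: each half of `BSD₂` on the slice gives back the corresponding one-sided law at every door datum -/

/-- **THE EULER-SYSTEM HALF ON THE SLICE ⟹ AN-28c(≥) at every door datum** (the one-sided form of g7's `doorIndexLawFullCAtTwo_of_bsdp`):
Gross–Zagier and Kolyvagin at `(N_W, W, K)`, GZK, modularity, `S_rankZeroTwin`, the proved Tamagawa law, and the per-datum iff
`missingUpperBoundAt_two_iff_doorLawGeC_at` read from left to right. [cite: GrossLMS1991, Thm. 1.3] [cite: Miller2011LMS, Def. 1.1] -/
theorem doorLawGeC_of_missingUpperBoundAt_onSlice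
    (hGZ : ∀ (N : ℕ) [NeZero N] (W : WeierstrassCurve ℚ) (K : Type) [Field K] [NumberField K], gross_zagier N W K)
    (hKo : ∀ (N : ℕ) [NeZero N] (W : WeierstrassCurve ℚ) (K : Type) [Field K] [NumberField K], kolyvagin N W K)
    (hGZK : rank_eq_analyticRank_of_analyticRank_le_one) (hmod : hasEntireLFunction_rat)
    (hU : ∀ (W : WeierstrassCurve ℚ) [W.IsElliptic] [W.IsGloballyMinimal],
      ¬ W.HasCM → (∀ n : ℕ, W.HasSurjectiveModNGaloisRep ((2 ^ n : ℕ) : ℤ)) → Odd W.torsionOrder → Odd W.tamagawaProduct →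
      W.analyticRank = 1 → MissingUpperBoundAt W 2)
    (hZ : S_rankZeroTwin)
    (W : WeierstrassCurve ℚ) [W.IsElliptic] [W.IsGloballyMinimal] [NeZero (W.conductorNorm ℤ)]
    (hCM : ¬ W.HasCM) (hsurj : ∀ n : ℕ, W.HasSurjectiveModNGaloisRep ((2 ^ n : ℕ) : ℤ)) (hT : Odd W.torsionOrder)
    (hc : Odd W.tamagawaProduct) (hr : W.analyticRank = 1)
    (K : Type) [Field K] [NumberField K] (hK : IsImaginaryQuadratic K) (hadm : DoorAdmissible W (NumberField.discr K))
    (hLt : (W.quadraticTwist (NumberField.discr K : ℚ)).entireLFunction 1 ≠ 0)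
    (Dt : ModularParametrizationData W (W.conductorNorm ℤ)) (H : HeegnerDatum (W.conductorNorm ℤ) (NumberField.discr K))
    (ι : K →+* ℂ) (P : (W.baseChange K).toAffine.Point)
    (hP : WeierstrassCurve.Affine.Point.map ι.toRatAlgHom P = heegnerPointComplex Dt H)
    (Wd : WeierstrassCurve ℚ) [Wd.IsElliptic] [Wd.IsGloballyMinimal] (Cd : VariableChange ℚ)
    (hWd : Cd • W.quadraticTwist (NumberField.discr K : ℚ) = Wd) :
    ∃ m : ℕ, HasTwoDivisibilityUpToTorsion W K P m ∧
      padicValNat 2 (Nat.card (AddCommGroup.primaryComponent W.sha 2)) +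
          padicValNat 2 (Nat.card (AddCommGroup.primaryComponent Wd.sha 2)) +
          transpCount W (NumberField.discr K) + 2 * identCount W (NumberField.discr K) + 2 * padicValInt 2 Dt.c ≤
        2 * m + (if W.Δ < 0 then 1 else 0) := by
  have hD0 : (NumberField.discr K : ℚ) ≠ 0 := by exact_mod_cast NumberField.discr_ne_zero K
  haveI hEt : (W.quadraticTwist (NumberField.discr K : ℚ)).IsElliptic := W.isElliptic_quadraticTwist hD0
  have hCMd : ¬ Wd.HasCM := RamifiedPairUpperBound.not_hasCM_of_smul_quadraticTwist_eq hD0 hWd hCM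
  have hLd : Wd.entireLFunction 1 ≠ 0 := by rw [← hWd, entireLFunction_smul]; exact hLt
  have hrd : Wd.analyticRank = 0 := (Wd.analyticRank_eq_zero_iff_holds (hmod Wd)).2 hLd
  have hBd : BSDp Wd 2 := hZ Wd hCMd hrd
  have hHN : SatisfiesHeegnerHypothesis (W.conductorNorm ℤ) K := satisfiesHeegnerHypothesis_of_doorAdmissible W K hK hadm
  have hrk : W.mordellWeilRank = 1 := by rw [(hGZK W (le_of_eq hr)).1, hr]
  exact (missingUpperBoundAt_two_iff_doorLawGeC_at hmod doorTwistTamagawaAtTwo W hT hc hr hrk K hK (hGZ _ W K) (hKo _ W K) hadm hHN hLt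
    Dt H ι P hP Wd Cd hWd hBd).mp (hU W hCM hsurj hT hc hr)

/-- **THE MAIN-CONJECTURE HALF ON THE SLICE ⟹ AN-28c(≤) at every door datum** (dual of `doorLawGeC_of_missingUpperBoundAt_onSlice`).
[cite: GrossLMS1991, §2 Conj. (2.2)] [cite: Miller2011LMS, Def. 1.1] -/
theorem doorLawLeC_of_missingLowerBoundAt_onSlice
    (hGZ : ∀ (N : ℕ) [NeZero N] (W : WeierstrassCurve ℚ) (K : Type) [Field K] [NumberField K], gross_zagier N W K)
    (hKo : ∀ (N : ℕ) [NeZero N] (W : WeierstrassCurve ℚ) (K : Type) [Field K] [NumberField K], kolyvagin N W K)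
    (hGZK : rank_eq_analyticRank_of_analyticRank_le_one) (hmod : hasEntireLFunction_rat)
    (hL : ∀ (W : WeierstrassCurve ℚ) [W.IsElliptic] [W.IsGloballyMinimal],
      ¬ W.HasCM → (∀ n : ℕ, W.HasSurjectiveModNGaloisRep ((2 ^ n : ℕ) : ℤ)) → Odd W.torsionOrder → Odd W.tamagawaProduct →
      W.analyticRank = 1 → MissingLowerBoundAt W 2)
    (hZ : S_rankZeroTwin)
    (W : WeierstrassCurve ℚ) [W.IsElliptic] [W.IsGloballyMinimal] [NeZero (W.conductorNorm ℤ)]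
    (hCM : ¬ W.HasCM) (hsurj : ∀ n : ℕ, W.HasSurjectiveModNGaloisRep ((2 ^ n : ℕ) : ℤ)) (hT : Odd W.torsionOrder)
    (hc : Odd W.tamagawaProduct) (hr : W.analyticRank = 1)
    (K : Type) [Field K] [NumberField K] (hK : IsImaginaryQuadratic K) (hadm : DoorAdmissible W (NumberField.discr K))
    (hLt : (W.quadraticTwist (NumberField.discr K : ℚ)).entireLFunction 1 ≠ 0)
    (Dt : ModularParametrizationData W (W.conductorNorm ℤ)) (H : HeegnerDatum (W.conductorNorm ℤ) (NumberField.discr K))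
    (ι : K →+* ℂ) (P : (W.baseChange K).toAffine.Point)
    (hP : WeierstrassCurve.Affine.Point.map ι.toRatAlgHom P = heegnerPointComplex Dt H)
    (Wd : WeierstrassCurve ℚ) [Wd.IsElliptic] [Wd.IsGloballyMinimal] (Cd : VariableChange ℚ)
    (hWd : Cd • W.quadraticTwist (NumberField.discr K : ℚ) = Wd) :
    ∃ m : ℕ, HasTwoDivisibilityUpToTorsion W K P m ∧
      2 * m + (if W.Δ < 0 then 1 else 0) ≤
        padicValNat 2 (Nat.card (AddCommGroup.primaryComponent W.sha 2)) +
          padicValNat 2 (Nat.card (AddCommGroup.primaryComponent Wd.sha 2)) +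
          transpCount W (NumberField.discr K) + 2 * identCount W (NumberField.discr K) + 2 * padicValInt 2 Dt.c := by
  have hD0 : (NumberField.discr K : ℚ) ≠ 0 := by exact_mod_cast NumberField.discr_ne_zero K
  haveI hEt : (W.quadraticTwist (NumberField.discr K : ℚ)).IsElliptic := W.isElliptic_quadraticTwist hD0
  have hCMd : ¬ Wd.HasCM := RamifiedPairUpperBound.not_hasCM_of_smul_quadraticTwist_eq hD0 hWd hCM
  have hLd : Wd.entireLFunction 1 ≠ 0 := by rw [← hWd, entireLFunction_smul]; exact hLt
  have hrd : Wd.analyticRank = 0 := (Wd.analyticRank_eq_zero_iff_holds (hmod Wd)).2 hLd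
  have hBd : BSDp Wd 2 := hZ Wd hCMd hrd
  have hHN : SatisfiesHeegnerHypothesis (W.conductorNorm ℤ) K := satisfiesHeegnerHypothesis_of_doorAdmissible W K hK hadm
  have hrk : W.mordellWeilRank = 1 := by rw [(hGZK W (le_of_eq hr)).1, hr]
  exact (missingLowerBoundAt_two_iff_doorLawLeC_at hmod doorTwistTamagawaAtTwo W hT hc hr hrk K hK (hGZ _ W K) (hKo _ W K) hadm hHN hLt
    Dt H ι P hP Wd Cd hWd hBd).mp (hL W hCM hsurj hT hc hr)

end Summit.BirchSwinnertonDyer.BirchSwinnertonDyer.Theorems.RankOneAtTwoOneDoor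

end
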